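import Summits.ValiantsHypothesis.ValiantsHypothesis.Theorems.NNDivisionHard.Negative.WeakReliefBlindTiltCore

/-!
# The weak-relief blindness identity, part 3b (§3 packaging): `inv_split`, ★★★ `tilt_identity`, `tiltInv_rankPlus_le` — the `{0,1}`-TILTED rows of `Q^Π_λ` are blind for `λ ≥ 4n+2`

PORT NOTE (staged by the AUTHOR val-idea-39 g4 for the Negative-lane port hand named by the desk — val-port-3 g3 per #365 (B)/#367; critic of record val-idea-crit-9 g2, V#66 booked §3 as N22's β-kernel leg): texts VERBATIM BY NAME from the crux workfile `Cruxes/NNDivisionHard/WeakReliefBlind39.lean` rev 5 @7c4a19848ae2 (sha16 c2e19d8d627dfa6a, lint-clean); the ONLY changes are the namespace (= parts 1–2, ✓ p679897 / ✓ p680161), the 400-line-cap SPLIT, and one-line docstrings on helper lemmas (gate lint).  VP ≠ VNP is NOT proved; the crux `NNDivisionHard` stays OPEN; `LocatedPencilLaw` is refuted in the kernel by ✓ p679540 (crit-9 α-leg) — these files are an INDEPENDENT certificate at the `{0,1}`-tilt level with λ ≥ 4n+2 (parts 3a/3b) and the small-class theorem for all λ ≥ 1 (part 4).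

Statement: `rank₊[(1−|a∩b|)² + |(a∖c)∩b| + |(c∖a)∖b| + λ·inv(c;π)] ≤ (n+1)²(10n²+4n+1)` for every `n` and every integer `λ ≥ 4n+2` (rows `(a,c)`, columns `(b,π)`);
the mechanism and proof technique are described in part 3a's module docstring (author's §3 text).
-/

-- the mandated summit-side namespace repeats a component by design (single-problem summit)
set_option linter.dupNamespace false

namespace Summit.ValiantsHypothesis.Theorems.NNDivisionHardNegative.WeakReliefBlind

open Finset
open Summit.ValiantsHypothesis.Theorems.NNDivisionHardNegative.BlindCubeIdentity
  (ind ind_nonneg ind_le_one ind_mul_self ind_inter sum_ind sum_ind_mul sum_ite_eq_sub)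

section Tilt
variable {n : ℕ}

/-! ### Lemma B — bubble-sort split of the inversion count at the located initial segment `P = P_k(π)` -/

/-- `inv(c;π) = |c∖P_k|·|P_k∖c| + E_k(c;π)`: every pair `(l ∈ c∖P_k, l′ ∈ P_k∖c)` is an inversion, no pair
`(l ∈ c∩P_k, l′ ∉ c ∪ P_k)` is, and `E_k` collects the inversions inside `P_k × P_k` and `P_kᶜ × P_kᶜ`. -/
theorem inv_split (c : Finset (Fin n)) (π : Equiv.Perm (Fin n)) (k : ℕ) :
    inv c π = (∑ l, ind c l * (1 - ind (posLT π k) l)) * (∑ l, lt c l * ind (posLT π k) l) +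
      ∑ l, ∑ l', ind c l * lt c l' * ((((1 - ind (posLT π k) l) * (1 - ind (posLT π k) l') +
        ind (posLT π k) l * ind (posLT π k) l') * invInd π l l')) := by
  unfold inv lt
  rw [Finset.sum_mul_sum, ← Finset.sum_add_distrib]
  refine Finset.sum_congr rfl fun l _ => ?_
  rw [← Finset.sum_add_distrib]
  refine Finset.sum_congr rfl fun l' _ => ?_
  conv_lhs => rw [invInd_split π k l l']
  simp only [← ind_posLT]
  ring

/-- column data given the announced classes `(k, m) = (|c|, |c∖a|)`: `D = |b ∩ P_k(π)| − m − 1` and `κ = [D ≥ 0]` -/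
def dee (b : Finset (Fin n)) (π : Equiv.Perm (Fin n)) (k m : ℕ) : ℤ := ((b ∩ posLT π k).card : ℤ) - m - 1
/-- `κ = [D ≥ 0]` -/
def kap (b : Finset (Fin n)) (π : Equiv.Perm (Fin n)) (k m : ℕ) : ℤ := if 0 ≤ dee b π k m then 1 else 0

/-- `κ = 1 ∧ D ≥ 0` or `κ = 0 ∧ D ≤ −1` -/
theorem kap_dichotomy (b : Finset (Fin n)) (π : Equiv.Perm (Fin n)) (k m : ℕ) :
    (kap b π k m = 1 ∧ 0 ≤ dee b π k m) ∨ (kap b π k m = 0 ∧ dee b π k m ≤ -1) := by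
  unfold kap; split_ifs with h
  · exact Or.inl ⟨rfl, h⟩
  · exact Or.inr ⟨rfl, by omega⟩

/-- `κ ∈ {0,1}` -/
theorem kap_cases (b : Finset (Fin n)) (π : Equiv.Perm (Fin n)) (k m : ℕ) : kap b π k m = 0 ∨ kap b π k m = 1 := by
  rcases kap_dichotomy b π k m with ⟨h, _⟩ | ⟨h, _⟩
  · exact Or.inr h
  · exact Or.inl h

/-- `D ≤ n − 1` -/
theorem dee_le (b : Finset (Fin n)) (π : Equiv.Perm (Fin n)) (k m : ℕ) : dee b π k m ≤ (n : ℤ) - 1 := by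
  unfold dee
  have h1 : (b ∩ posLT π k).card ≤ n := by simpa using Finset.card_le_univ (b ∩ posLT π k)
  have h2 : ((b ∩ posLT π k).card : ℤ) ≤ n := by exact_mod_cast h1
  have h3 : (0 : ℤ) ≤ m := Nat.cast_nonneg m
  linarith

/-- the tilted left-hand side `S(a,c;b,π) = (1−|a∩b|)² + |(a∖c)∩b| + |(c∖a)∖b| + λ·inv(c;π)` (an integer) -/
def tiltLHS (lam : ℤ) (a c b : Finset (Fin n)) (π : Equiv.Perm (Fin n)) : ℤ :=
  (1 - ((a ∩ b).card : ℤ)) ^ 2 + (((a \ c) ∩ b).card : ℤ) + (((c \ a) \ b).card : ℤ) + lam * inv c π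

/-- ★★★ **THE TILTED PERMUTAHEDRAL IDENTITY** (all `n`, all `λ`, every tilted row `(a, c)` and column `(b, π)`; sorry-free):
`S(a,c;b,π) = certG λ κ D n a c b P_{|c|}(π) [π(l′)<π(l)]` with `D = |b∩P_{|c|}| − |c∖a| − 1`, `κ = [D ≥ 0]`. -/
theorem tilt_identity (lam : ℤ) (a c b : Finset (Fin n)) (π : Equiv.Perm (Fin n)) :
    tiltLHS lam a c b π = certG lam (kap b π c.card (c \ a).card) (dee b π c.card (c \ a).card) (n : ℤ) a c b
      (posLT π c.card) (invInd π) := by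
  have hkn : c.card ≤ n := by simpa using Finset.card_le_univ c
  unfold tiltLHS
  rw [inv_split c π c.card]
  exact tilt_core lam _ _ a c b (posLT π c.card) (invInd π) (card_posLT π hkn) (by unfold dee; rfl)
    (kap_cases b π c.card (c \ a).card)

/-! ### packaging: `rank₊ S ≤ (n+1)²·(10n² + 4n + 1)` -/

/-- index of the packaged tilted certificate: announced classes `(k, m) = (|c|, |c∖a|) ∈ {0,…,n}²` times `TIdx n`;
`|TPIdx n| = (n+1)²(10n² + 4n + 1)`. -/
abbrev TPIdx (n : ℕ) := (Fin (n + 1) × Fin (n + 1)) × TIdx n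

/-- `|TPIdx n| = (n+1)²(10n²+4n+1)` -/
theorem card_TPIdx (n : ℕ) : Fintype.card (TPIdx n) = (n + 1) ^ 2 * (10 * n ^ 2 + 4 * n + 1) := by
  simp [TPIdx, TIdx, Fintype.card_sum, Fintype.card_prod, Fintype.card_fin]; ring

/-- row factors of one tilted row `(a, c)` -/
def tRow (a c : Finset (Fin n)) : TIdx n → ℤ :=
  Sum.elim (fun _ => 1) (Sum.elim (fun jl => singRow a c jl.1 jl.2) (fun jll => pairRow a c jll.1 jll.2.1 jll.2.2))

/-- column factors of one column `(b, π)` at announced classes `(k, m)` -/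
def tCol (lam : ℤ) (b : Finset (Fin n)) (π : Equiv.Perm (Fin n)) (k m : ℕ) : TIdx n → ℤ :=
  Sum.elim (fun _ => constColG (kap b π k m) (dee b π k m))
    (Sum.elim (fun jl => singColG lam (kap b π k m) (dee b π k m) (n : ℤ) b (posLT π k) jl.1 jl.2)
      (fun jll => pairColG lam (kap b π k m) b (posLT π k) (invInd π) jll.1 jll.2.1 jll.2.2))

/-- the identity in packaged form for ONE row -/
theorem tilt_identity' (lam : ℤ) (a c b : Finset (Fin n)) (π : Equiv.Perm (Fin n)) :
    tiltLHS lam a c b π = ∑ s, tRow a c s * tCol lam b π c.card (c \ a).card s := by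
  rw [tilt_identity lam a c b π]
  unfold certG tRow tCol
  simp only [Fintype.sum_sum_type, Fintype.sum_prod_type, Sum.elim_inl, Sum.elim_inr, Fintype.sum_unique, one_mul]
  ring

/-- pair-family row factors are nonnegative -/
theorem pairRow_nonneg (a c : Finset (Fin n)) (j : Fin 10) (l l' : Fin n) : 0 ≤ pairRow a c j l l' := by
  have h1 := ca_nonneg a c l; have h2 := ca_nonneg a c l'; have h3 := lv_nonneg a c l; have h4 := lv_nonneg a c l'
  have h5 := gh_nonneg a c l; have h6 := gh_nonneg a c l'; have h7 := lt_nonneg c l; have h8 := lt_nonneg c l'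
  have h9 := gh_le_one a c l'; have h10 := ind_nonneg c l
  fin_cases j <;> simp [pairRow]
  all_goals apply_rules [mul_nonneg]
  all_goals linarith

/-- single-family row factors are nonnegative -/
theorem singRow_nonneg (a c : Finset (Fin n)) (j : Fin 4) (l : Fin n) : 0 ≤ singRow a c j l := by
  have h3 := lv_nonneg a c l; have h5 := gh_nonneg a c l; have h7 := lt_nonneg c l; have h10 := ind_nonneg c l
  fin_cases j <;> simp [singRow] <;> linarith

/-- tilted row factors are nonnegative -/
theorem tRow_nonneg (a c : Finset (Fin n)) (s : TIdx n) : 0 ≤ tRow a c s := by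
  rcases s with u | ⟨j, l⟩ | ⟨j, l, l'⟩
  · simp [tRow]
  · simpa [tRow] using singRow_nonneg a c j l
  · simpa [tRow] using pairRow_nonneg a c j l l'

/-- the constant slot is nonnegative in both `κ` branches -/
theorem constColG_nonneg {κ D : ℤ} (h : (κ = 1 ∧ 0 ≤ D) ∨ (κ = 0 ∧ D ≤ -1)) : 0 ≤ constColG κ D := by
  unfold constColG; rcases h with ⟨rfl, hd⟩ | ⟨rfl, hd⟩ <;> nlinarith

/-- single-family column factors are nonnegative for `λ ≥ 4n+2` -/
theorem singColG_nonneg {lam κ D nn : ℤ} (b P : Finset (Fin n)) (hlam : 4 * nn + 2 ≤ lam) (hn : 0 ≤ nn)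
    (hD : D ≤ nn - 1) (h : (κ = 1 ∧ 0 ≤ D) ∨ (κ = 0 ∧ D ≤ -1)) : ∀ j l, 0 ≤ singColG lam κ D nn b P j l := by
  have hB0 := ind_nonneg b; have hB1 := ind_le_one b; have hP0 := ind_nonneg P; have hP1 := ind_le_one P
  have hl0 : 0 ≤ lam := by linarith
  have hw : 0 ≤ lam - 2 - 2 * nn - 2 * D := by rcases h with ⟨_, hd⟩ | ⟨_, hd⟩ <;> linarith
  simp only [Fin.forall_fin_succ, IsEmpty.forall_iff, and_true, singColG, Matrix.cons_val_zero, Matrix.cons_val_succ]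
  rcases h with ⟨rfl, hd⟩ | ⟨rfl, hd⟩ <;> refine ⟨fun l => ?_, fun l => ?_, fun l => ?_, fun l => ?_⟩
  all_goals
    have hb0 := hB0 l; have hp0 := hP0 l
    have hb1 : 0 ≤ 1 - ind b l := by linarith [hB1 l]
    have hp1 : 0 ≤ 1 - ind P l := by linarith [hP1 l]
    have hv : 0 ≤ lam - ind b l := by linarith [hB1 l]
    try simp only [sub_self, zero_mul, zero_add, add_zero, sub_zero, one_mul]
    generalize 1 - ind b l = yb at hb1 ⊢
    generalize 1 - ind P l = yp at hp1 ⊢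
    generalize lam - 2 - 2 * nn - 2 * D = w at hw ⊢
    generalize lam - ind b l = v at hv ⊢
    positivity

/-- pair-family column factors are nonnegative for `λ ≥ 4n+2` -/
theorem pairColG_nonneg {lam κ : ℤ} (b P : Finset (Fin n)) (I : Fin n → Fin n → ℤ) (hI : ∀ l l', 0 ≤ I l l')
    (hlam : 2 ≤ lam) (h : κ = 0 ∨ κ = 1) : ∀ j l l', 0 ≤ pairColG lam κ b P I j l l' := by
  have hB0 := ind_nonneg b; have hB1 := ind_le_one b; have hP0 := ind_nonneg P; have hP1 := ind_le_one P
  have hl0 : 0 ≤ lam := by linarith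
  have hl2 : 0 ≤ lam - 2 := by linarith
  simp only [Fin.forall_fin_succ, IsEmpty.forall_iff, and_true, pairColG, Matrix.cons_val_zero, Matrix.cons_val_succ]
  rcases h with rfl | rfl <;>
    refine ⟨fun l l' => ?_, fun l l' => ?_, fun l l' => ?_, fun l l' => ?_, fun l l' => ?_, fun l l' => ?_,
      fun l l' => ?_, fun l l' => ?_, fun l l' => ?_, fun l l' => ?_⟩
  all_goals
    have hb0 := hB0 l; have hp0 := hP0 l; have hb0' := hB0 l'; have hp0' := hP0 l'
    have hi := hI l l'; have ho := offd_nonneg l l'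
    have hb1 : 0 ≤ 1 - ind b l := by linarith [hB1 l]
    have hp1 : 0 ≤ 1 - ind P l := by linarith [hP1 l]
    have hb1' : 0 ≤ 1 - ind b l' := by linarith [hB1 l']
    have hp1' : 0 ≤ 1 - ind P l' := by linarith [hP1 l']
    try simp only [sub_self, zero_mul, mul_zero, zero_add, add_zero, sub_zero, one_mul]
    generalize 1 - ind b l = yb at hb1 ⊢
    generalize 1 - ind P l = yp at hp1 ⊢
    generalize 1 - ind b l' = yb' at hb1' ⊢
    generalize 1 - ind P l' = yp' at hp1' ⊢
    generalize lam - 2 = z at hl2 ⊢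
    generalize offd l l' = o at ho ⊢
    generalize I l l' = i at hi ⊢
    positivity

/-- tilted column factors are nonnegative for `λ ≥ 4n+2` -/
theorem tCol_nonneg {lam : ℤ} (hlam : 4 * (n : ℤ) + 2 ≤ lam) (b : Finset (Fin n)) (π : Equiv.Perm (Fin n)) (k m : ℕ)
    (s : TIdx n) : 0 ≤ tCol lam b π k m s := by
  have hDn : dee b π k m ≤ (n : ℤ) - 1 := dee_le b π k m
  have hn0 : (0 : ℤ) ≤ n := Nat.cast_nonneg n
  rcases s with u | ⟨j, l⟩ | ⟨j, l, l'⟩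
  · simpa only [tCol, Sum.elim_inl] using constColG_nonneg (kap_dichotomy b π k m)
  · simpa only [tCol, Sum.elim_inr, Sum.elim_inl] using
      singColG_nonneg b (posLT π k) hlam hn0 hDn (kap_dichotomy b π k m) j l
  · simpa only [tCol, Sum.elim_inr] using
      pairColG_nonneg b (posLT π k) (invInd π) (invInd_nonneg π) (by linarith) (kap_cases b π k m) j l l'

/-- ★★★ **`rank₊ S ≤ (n+1)²(10n² + 4n + 1)` for every `n` and every integer `λ ≥ 4n + 2`**: nonnegative
`U : Finset (Fin n) × Finset (Fin n) → TPIdx n → ℝ` (rows `(a, c)`), `V : Finset (Fin n) × Equiv.Perm (Fin n) → TPIdx n → ℝ`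
(columns `(b, π)`) with `(1 − |a∩b|)² + |(a∖c)∩b| + |(c∖a)∖b| + λ·inv(c;π) = Σ_s U (a,c) s · V (b,π) s` for ALL `a, c, b, π` —
the `{0,1}`-tilted rows of the diagonal permutahedron passenger `Q^Π_λ` (critic N22 STEP 3) are BLIND with `O(n⁴)` slots. -/
theorem tiltInv_rankPlus_le (n : ℕ) (lam : ℤ) (hlam : 4 * (n : ℤ) + 2 ≤ lam) :
    ∃ (U : Finset (Fin n) × Finset (Fin n) → TPIdx n → ℝ) (V : Finset (Fin n) × Equiv.Perm (Fin n) → TPIdx n → ℝ),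
      (∀ ac s, 0 ≤ U ac s) ∧ (∀ bπ s, 0 ≤ V bπ s) ∧
      ∀ (a c b : Finset (Fin n)) (π : Equiv.Perm (Fin n)),
        ((1 : ℝ) - ((a ∩ b).card : ℝ)) ^ 2 + (((a \ c) ∩ b).card : ℝ) + (((c \ a) \ b).card : ℝ) +
          (lam : ℝ) * (inv c π : ℝ) = ∑ s, U (a, c) s * V (b, π) s := by
  classical
  refine ⟨fun ac s => if (s.1.1 : ℕ) = ac.2.card ∧ (s.1.2 : ℕ) = (ac.2 \ ac.1).card then (tRow ac.1 ac.2 s.2 : ℝ) else 0,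
    fun bπ s => (tCol lam bπ.1 bπ.2 (s.1.1 : ℕ) (s.1.2 : ℕ) s.2 : ℝ), ?_, ?_, ?_⟩
  · intro ac s
    dsimp only
    split_ifs
    · exact_mod_cast tRow_nonneg ac.1 ac.2 s.2
    · exact le_rfl
  · intro bπ s
    dsimp only
    exact_mod_cast tCol_nonneg hlam bπ.1 bπ.2 _ _ s.2
  · intro a c b π
    have hkn : c.card < n + 1 := by
      have : c.card ≤ n := by simpa using Finset.card_le_univ c
      omega
    have hmn : (c \ a).card < n + 1 := by
      have : (c \ a).card ≤ n := by simpa using Finset.card_le_univ (c \ a)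
      omega
    have h := congrArg (fun z : ℤ => (z : ℝ)) (tilt_identity' lam a c b π)
    simp only [tiltLHS, Int.cast_add, Int.cast_pow, Int.cast_sub, Int.cast_one, Int.cast_mul, Int.cast_natCast,
      Int.cast_sum] at h
    rw [h, Fintype.sum_prod_type]
    rw [Finset.sum_eq_single ((⟨c.card, hkn⟩, ⟨(c \ a).card, hmn⟩) : Fin (n + 1) × Fin (n + 1))]
    · simp
    · rintro ⟨k, m⟩ _ hk
      have : ¬ ((k : ℕ) = c.card ∧ (m : ℕ) = (c \ a).card) := by
        rintro ⟨e1, e2⟩; exact hk (Prod.ext (Fin.ext e1) (Fin.ext e2))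
      simp [this]
    · intro h; exact absurd (Finset.mem_univ _) h

end Tilt

end Summit.ValiantsHypothesis.Theorems.NNDivisionHardNegative.WeakReliefBlind
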